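import Literature.NumberTheory.GaloisRepresentations.LocalGaloisGroupHenselProofs
import Literature.NumberTheory.GaloisRepresentations.LocalGaloisGroupProofs
import Literature.NumberTheory.GaloisRepresentations.RamificationFiltration
import Mathlib.Analysis.Normed.Module.FiniteDimension
import HarnessLib

/-!
# The integers of a finite subextension of `F̄/F`, `F` a local field (trunk GalRep, item C4/C9)

For a non-archimedean local field `F` and a *finite* subextension `E/F` of `F̄` — separable or
not — the ring `O_E = integralClosure 𝒪[F] E` is a finitely generated `𝒪[F]`-module
(`Literature.NumberTheory.GaloisRepresentations.module_finite_integralClosure`); in particular it is noetherian, which is the input for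
`O_E` being a discrete valuation ring also in the inseparable case.  The separable case is
Mathlib's `IsIntegralClosure.finite` (used in `TameInertiaCyclicProofs` for Galois `E`); the
inseparable case arises for the finite *normal* layers of `F̄` over a local field of
characteristic `p` (cf. the definition of `absUpperInertia F v`, `RamificationFiltration.lean`,
and `SerreWeightExistenceProofs.lean`, which treats those layers through the relative Frobenius).

Proof of finiteness (Serre, *Local Fields*, Ch. II §2, Prop. 3, "`B` is a free `A`-module of rank
`n`", for complete `A`): the valuation of the complete field `F` extends to `F̄` as the spectral
norm `|·|_sp` (Mathlib), and `O_E` is contained in the closed unit ball of `E`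
(`LocalGaloisGroupHenselProofs.mem_absIntegers_integer_iff_spectralNorm_le_one`); the coordinate
forms of an `F`-basis of the finite-dimensional normed space `E` are continuous, hence bounded by
some `‖ϖ‖^{-N}`, so `ϖ^N O_E ⊆ ⊕ 𝒪[F] bᵢ` and `O_E` is a submodule of a finitely generated
module over the noetherian ring `𝒪[F]`.

## References

* J.-P. Serre, *Local Fields*, GTM 67 (1979), Ch. II §2, Prop. 3 and its proof.
  [SerreLocalFields1979]
* S. Bosch, U. Güntzer, R. Remmert, *Non-Archimedean Analysis*, 3.2 (spectral norm), as in Mathlib.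
-/

noncomputable section

open scoped Pointwise
open ValuativeRel Field Polynomial

namespace Literature.NumberTheory.GaloisRepresentations


universe u

variable (F : Type u) [Field F] [ValuativeRel F] [TopologicalSpace F] [IsNonarchimedeanLocalField F]

/-! ### Finiteness of `O_E` over `𝒪[F]` -/

section Finite

/-- **`O_E` is a finitely generated `𝒪[F]`-module** for every finite subextension `E/F` of `F̄`
(no separability assumed): `O_E` lies in the unit ball of the spectral norm of `E`, the
coordinates in an `F`-basis are bounded linear forms on the finite-dimensional normed space `E`
over the complete field `F`, so `ϖ^N O_E` lies in the `𝒪[F]`-span of the basis for `N ≫ 0`.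
Ref: Serre, *Local Fields*, Ch. II §2, Prop. 3. [cite: SerreLocalFields1979, Ch. II §2 Prop. 3] -/
theorem module_finite_integralClosure (E : IntermediateField F (AlgebraicClosure F))
    [FiniteDimensional F E] : Module.Finite 𝒪[F] (integralClosure 𝒪[F] E) := by
  classical
  -- the rank-one norm on `F` attached to `valuation F` (as in `LocalGaloisGroupHenselProofs`)
  letI := IsTopologicalAddGroup.rightUniformSpace F
  haveI := isUniformAddGroup_of_addCommGroup (G := F)
  letI hv : (Valued.v (R := F)).RankOne :=
  { hom' := IsRankLeOne.nonempty.some.emb (R := F) |>.comp MonoidWithZeroHom.ValueGroup₀.embedding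
    strictMono' := IsRankLeOne.nonempty.some.strictMono.comp
        MonoidWithZeroHom.ValueGroup₀.embedding_strictMono }
  letI := Valued.toNontriviallyNormedField F (ValueGroupWithZero F)
  have hw : ∀ x : F, valuation F x ≤ 1 ↔ ‖x‖ ≤ 1 := fun x =>
    (Valued.toNormedField.norm_le_one_iff (L := F) (Γ₀ := ValueGroupWithZero F)).symm
  -- the spectral norm on `E`
  letI : NormedAddCommGroup E := spectralNorm.normedAddCommGroup F E
  letI : NormedSpace F E := spectralNorm.normedSpace F E
  -- `O_E` lies in the closed unit ball
  have hball : ∀ x : E, x ∈ integralClosure 𝒪[F] E → ‖x‖ ≤ 1 := by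
    intro x hx
    have hx' : (x : AlgebraicClosure F) ∈ absIntegers 𝒪[F] F := by
      change (x : AlgebraicClosure F) ∈ integralClosure 𝒪[F] (AlgebraicClosure F)
      rw [mem_integralClosure_iff]
      exact (isIntegral_algHom_iff (E.val.restrictScalars 𝒪[F])
        (show Function.Injective (E.val.restrictScalars 𝒪[F]) from fun _ _ h => Subtype.ext h)).mpr hx
    have h1 := (mem_absIntegers_integer_iff_spectralNorm_le_one (w := valuation F) hw
      (x : AlgebraicClosure F)).mp hx'
    change spectralNorm F E x ≤ 1
    rw [spectralNorm.eq_of_tower (L := AlgebraicClosure F)]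
    exact h1
  -- an `F`-basis and bounds for its coordinate forms
  set b := Module.finBasis F E with hb
  have hbound : ∀ i, ∃ C : ℝ, 0 < C ∧ ∀ x : E, ‖b.coord i x‖ ≤ C * ‖x‖ := by
    intro i
    refine ⟨‖LinearMap.toContinuousLinearMap (b.coord i)‖ + 1, by positivity, fun x => ?_⟩
    calc ‖b.coord i x‖ = ‖LinearMap.toContinuousLinearMap (b.coord i) x‖ := rfl
      _ ≤ ‖LinearMap.toContinuousLinearMap (b.coord i)‖ * ‖x‖ := ContinuousLinearMap.le_opNorm _ _
      _ ≤ (‖LinearMap.toContinuousLinearMap (b.coord i)‖ + 1) * ‖x‖ := by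
          gcongr; exact (lt_add_one _).le
  choose C hC0 hC using hbound
  -- a uniformiser and an exponent `N` with `C i * ‖ϖ‖ ^ N ≤ 1` for all `i`
  obtain ⟨ϖ, hϖ⟩ := IsDiscreteValuationRing.exists_irreducible 𝒪[F]
  have hϖ1 : ‖(ϖ : F)‖ < 1 := by
    rw [← valuation_lt_one_iff_norm_lt_one_of_le hw]
    exact Valuation.Integer.not_isUnit_iff_valuation_lt_one.mp hϖ.not_isUnit
  have hϖ0 : (ϖ : F) ≠ 0 := fun h => hϖ.ne_zero (Subtype.ext h)
  have hN : ∀ i, ∃ N : ℕ, C i * ‖(ϖ : F)‖ ^ N ≤ 1 := by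
    intro i
    obtain ⟨N, hN⟩ := exists_pow_lt_of_lt_one (inv_pos.mpr (hC0 i)) hϖ1
    refine ⟨N, ?_⟩
    rw [← le_div_iff₀' (hC0 i), one_div]
    exact hN.le
  choose N hN using hN
  set M : ℕ := Finset.univ.sup N with hM
  have hNM : ∀ i, C i * ‖(ϖ : F)‖ ^ M ≤ 1 := fun i =>
    (mul_le_mul_of_nonneg_left (pow_le_pow_of_le_one (norm_nonneg _) hϖ1.le
      (Finset.le_sup (Finset.mem_univ i))) (hC0 i).le).trans (hN i)
  -- the finitely generated module `⊕ 𝒪[F] ϖ^{-M} bᵢ`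
  set b' : Fin (Module.finrank F E) → E := fun i => ((ϖ : F) ^ M)⁻¹ • b i with hb'
  set P : Submodule 𝒪[F] E := Submodule.span 𝒪[F] (Set.range b') with hP
  have hPfg : P.FG := Submodule.fg_span (Set.finite_range b')
  haveI : IsNoetherian 𝒪[F] P := isNoetherian_of_fg_of_noetherian _ hPfg
  -- `O_E ⊆ P`
  have hle : ∀ x : E, x ∈ integralClosure 𝒪[F] E → x ∈ P := by
    intro x hx
    have hx1 := hball x hx
    rw [← b.sum_repr x]
    refine Submodule.sum_mem _ fun i _ => ?_
    -- `b.repr x i = (b.repr x i * ϖ^M) * ϖ^{-M}` with the first factor in `𝒪[F]`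
    have hai : ‖b.repr x i * (ϖ : F) ^ M‖ ≤ 1 := by
      rw [norm_mul, norm_pow]
      calc ‖b.repr x i‖ * ‖(ϖ : F)‖ ^ M ≤ C i * ‖x‖ * ‖(ϖ : F)‖ ^ M :=
            mul_le_mul_of_nonneg_right (hC i x) (pow_nonneg (norm_nonneg _) _)
        _ ≤ C i * 1 * ‖(ϖ : F)‖ ^ M :=
            mul_le_mul_of_nonneg_right (mul_le_mul_of_nonneg_left hx1 (hC0 i).le)
              (pow_nonneg (norm_nonneg _) _)
        _ ≤ 1 := by rw [mul_one]; exact hNM i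
    have hmem : valuation F (b.repr x i * (ϖ : F) ^ M) ≤ 1 := (hw _).mpr hai
    set a : 𝒪[F] := ⟨b.repr x i * (ϖ : F) ^ M, hmem⟩ with ha
    have hsmul : b.repr x i • b i = a • b' i := by
      rw [hb']
      change b.repr x i • b i = (a : F) • (((ϖ : F) ^ M)⁻¹ • b i)
      rw [smul_smul, ha]
      change b.repr x i • b i = (b.repr x i * (ϖ : F) ^ M * ((ϖ : F) ^ M)⁻¹) • b i
      rw [mul_inv_cancel_right₀ (pow_ne_zero M hϖ0)]
    rw [hsmul]
    exact P.smul_mem a (Submodule.subset_span ⟨i, rfl⟩)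
  -- conclude
  let f : integralClosure 𝒪[F] E →ₗ[𝒪[F]] P :=
    { toFun := fun x => ⟨(x : E), hle x x.2⟩
      map_add' := fun x y => rfl
      map_smul' := fun c x => rfl }
  have hf : Function.Injective f := fun x y h => Subtype.ext (congrArg Subtype.val h :)
  exact Module.Finite.of_injective f hf

end Finite

end Literature.NumberTheory.GaloisRepresentations
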